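import Mathlib.Analysis.InnerProductSpace.Harmonic.Constructions
import Mathlib.Analysis.Complex.LocallyUniformLimit
import Mathlib.Analysis.Complex.Trigonometric
import Mathlib.Analysis.SpecialFunctions.Trigonometric.Deriv
import Literature.Analysis.Complex.StripResidueFormula
import Literature.Analysis.Complex.DeBruijnUniversalFactorsProofs
import Literature.Analysis.SpecialFunctions.GammaVerticalBounds
import HarnessLib

/-!
# The sine–sinh modes of the box Dirichlet problem are harmonic, and so are their series

Topic `Literature/Analysis/Complex`. The Fourier solution of the Dirichlet problem on the unit box
with data on the top side, `u(x, y) = ∑_k c_k sin(πkx) sinh(πky)/sinh(πk)` (Courant–Friedrichs–Lewy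
1928, §2; the continuum counterpart of the lattice `topExtension` of
`Probability/LatticeModels/BoxDirichlet.lean`), is harmonic on the open strip `{|Im z| < 1}` for
every BOUNDED coefficient sequence `c`: each mode `sin(πkx) sinh(πky)` is the real part of the entire
function `i cos(πkz)` (`boxMode_eq_re`), and `∑_k c_k i cos(πkz)/sinh(πk)` converges locally
uniformly on the strip (`|cos(πkz)| ≤ cosh(πky) ≤ e^{πk|y|}`, `sinh(πk) ≥ e^{πk}/4`), hence is holomorphic
there (Mathlib `differentiableOn_tsum_of_summable_norm`) and its real part harmonic
(`AnalyticAt.harmonicAt_re`). This is the continuum side of Lawler–Schramm–Werner's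
"continuous harmonic approximation" (Ann. Probab. 32 (2004), Lemma 5.3) in box geometry: the
locally uniform limits of the lattice Poisson sums of `BoxDirichlet.lean` are such series.

* `boxMode k z = sin(πk·re z) sinh(πk·im z)`, `boxMode_eq_re`, `harmonicAt_boxMode`;
* `norm_boxModeC_div_sinh_le` (`‖c/sinh(πk) · i cos(πkz)‖ ≤ 4|c|e^{-πkη}` on `|im z| ≤ 1 - η`), from
  the tree's `GammaVert.norm_cos_le_cosh_im`, `DeBruijn1950.cosh_le_exp_abs`, `exp_div_four_le_sinh`;
* **`harmonicOnNhd_boxModeSeries`** — for `|c k| ≤ C`, `z ↦ ∑' k, c k / sinh(πk) · boxMode k z` is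
  harmonic on `{z | |im z| < 1}`, and equals the real part of the holomorphic
  `∑' k, c k / sinh(πk) · (i cos(πkz))` there (`boxModeSeries_eq_re_tsum`).

## References

* R. Courant, K. Friedrichs, H. Lewy, Math. Ann. 100 (1928) 32–74, §2 [folklore].
* G. F. Lawler, O. Schramm, W. Werner, Ann. Probab. 32 (2004) 939–995, Lemma 5.3 [LawlerSchrammWerner2004].
-/

noncomputable section

open Complex Filter Set InnerProductSpace
open scoped Real Topology

namespace Literature.Analysis.Complex

/-! ### The modes -/

/-- The `k`-th **box mode** `sin(πk x) sinh(πk y)` at `z = x + iy`. [folklore] -/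
def boxMode (k : ℕ) (z : ℂ) : ℝ := Real.sin (π * k * z.re) * Real.sinh (π * k * z.im)

/-- The complexified mode: the entire function `z ↦ i cos(πk z)`. [folklore] -/
def boxModeC (k : ℕ) (z : ℂ) : ℂ := I * Complex.cos (π * k * z)

/-- **`sin(πkx) sinh(πky) = Re(i cos(πk(x+iy)))`**. [folklore] -/
theorem boxMode_eq_re (k : ℕ) (z : ℂ) : boxMode k z = (boxModeC k z).re := by
  rw [boxModeC, Complex.cos_eq, ← Complex.ofReal_cos, ← Complex.ofReal_sin, ← Complex.ofReal_cosh,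
    ← Complex.ofReal_sinh]
  have hre : ((π : ℂ) * k * z).re = π * k * z.re := by simp [mul_assoc]
  have him : ((π : ℂ) * k * z).im = π * k * z.im := by simp [mul_assoc]
  rw [hre, him]
  simp only [boxMode, Complex.mul_re, Complex.mul_im, Complex.sub_re, Complex.sub_im, Complex.I_re,
    Complex.I_im, Complex.ofReal_re, Complex.ofReal_im]
  ring

/-- The complexified mode is entire (differentiable everywhere). [folklore] -/
theorem differentiable_boxModeC (k : ℕ) : Differentiable ℂ (boxModeC k) := by
  unfold boxModeC
  refine Differentiable.const_mul ?_ I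
  exact Complex.differentiable_cos.comp (differentiable_id.const_mul _)

/-- **Each box mode is harmonic** on all of `ℂ` (real part of an entire function). [folklore] -/
theorem harmonicAt_boxMode (k : ℕ) (z : ℂ) : HarmonicAt (boxMode k) z := by
  have h : boxMode k = fun w => (boxModeC k w).re := funext (boxMode_eq_re k)
  rw [h]
  exact ((differentiable_boxModeC k).analyticAt z).harmonicAt_re

/-! ### Growth of the modes and decay of the normalisation -/

/-- The normalised mode bound on the strip `|im z| ≤ 1 - η`:
`‖c/sinh(πk) · i cos(πkz)‖ ≤ 4|c| e^{-πkη}` (trivial for `k = 0`, where the term vanishes). [folklore] -/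
theorem norm_boxModeC_div_sinh_le (k : ℕ) (c : ℝ) {η : ℝ} {z : ℂ} (hz : |z.im| ≤ 1 - η) :
    ‖(c / Real.sinh (π * k) : ℝ) * boxModeC k z‖ ≤ 4 * |c| * Real.exp (-(π * k * η)) := by
  rcases Nat.eq_zero_or_pos k with rfl | hk
  · simp only [Nat.cast_zero, mul_zero, zero_mul, Real.sinh_zero, div_zero, Complex.ofReal_zero, norm_zero,
      neg_zero, Real.exp_zero, mul_one]
    positivity
  have hk1 : (1 : ℝ) ≤ k := by exact_mod_cast hk
  have hπk : 1 ≤ π * k := by nlinarith [Real.two_le_pi]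
  have hπk0 : 0 < π * k := by linarith
  have hsinh : 0 < Real.sinh (π * k) := by
    rw [Real.sinh_eq]
    have := Real.exp_lt_exp.2 (show -(π * k) < π * k by linarith)
    linarith
  have hsinh' : Real.exp (π * k) / 4 ≤ Real.sinh (π * k) := exp_div_four_le_sinh hπk
  rw [norm_mul, Complex.norm_real, Real.norm_eq_abs, abs_div, abs_of_pos hsinh, boxModeC, norm_mul,
    Complex.norm_I, one_mul]
  have hcos : ‖Complex.cos (π * k * z)‖ ≤ Real.exp (π * k * (1 - η)) := by
    refine ((Literature.Analysis.SpecialFunctions.GammaVert.norm_cos_le_cosh_im _).trans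
      (DeBruijn1950.cosh_le_exp_abs _)).trans (Real.exp_le_exp.2 ?_)
    have him : ((π : ℂ) * k * z).im = π * k * z.im := by simp [mul_assoc]
    rw [him, abs_mul, abs_of_pos hπk0]
    exact mul_le_mul_of_nonneg_left hz hπk0.le
  have hdiv : |c| / Real.sinh (π * k) ≤ |c| / (Real.exp (π * k) / 4) :=
    div_le_div_of_nonneg_left (abs_nonneg c) (by positivity) hsinh'
  calc |c| / Real.sinh (π * k) * ‖Complex.cos (π * k * z)‖
      ≤ |c| / (Real.exp (π * k) / 4) * Real.exp (π * k * (1 - η)) :=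
        mul_le_mul hdiv hcos (norm_nonneg _) (by positivity)
    _ = 4 * |c| * (Real.exp (π * k * (1 - η)) / Real.exp (π * k)) := by ring
    _ = 4 * |c| * Real.exp (-(π * k * η)) := by rw [← Real.exp_sub]; ring_nf

/-! ### The series -/

/-- The **box-mode series** `∑' k, c k / sinh(πk) · sin(πkx) sinh(πky)`. [folklore] -/
def boxModeSeries (c : ℕ → ℝ) (z : ℂ) : ℝ := ∑' k, c k / Real.sinh (π * k) * boxMode k z

/-- The complexified series `∑' k, c k / sinh(πk) · i cos(πkz)`. [folklore] -/
def boxModeSeriesC (c : ℕ → ℝ) (z : ℂ) : ℂ := ∑' k, ((c k / Real.sinh (π * k) : ℝ) : ℂ) * boxModeC k z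

/-- The summable majorant on the strip `|im z| < 1 - η` (`η > 0`): `k ↦ 4 C e^{-πkη}` (with the
`k = 0` term, which vanishes in the series, bounded separately). [folklore] -/
theorem summable_majorant (C : ℝ) {η : ℝ} (hη : 0 < η) :
    Summable fun k : ℕ => 4 * C * Real.exp (-(π * k * η)) := by
  have h : (fun k : ℕ => 4 * C * Real.exp (-(π * k * η))) = fun k : ℕ => 4 * C * Real.exp (-(π * η)) ^ k := by
    funext k
    rw [← Real.exp_nat_mul]; ring_nf
  rw [h]
  refine Summable.mul_left _ (summable_geometric_of_lt_one (Real.exp_pos _).le ?_)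
  have h1 : Real.exp (-(π * η)) < Real.exp 0 := Real.exp_lt_exp.2 (by nlinarith [Real.pi_pos])
  simpa using h1

/-- **The complexified series is holomorphic on the strip** `{|im z| < 1}` (locally uniform
convergence from the majorant, Mathlib `differentiableOn_tsum_of_summable_norm` on each sub-strip
`{|im z| < 1 - η}`). [folklore] -/
theorem differentiableOn_boxModeSeriesC {c : ℕ → ℝ} {C : ℝ} (hc : ∀ k, |c k| ≤ C) {η : ℝ} (hη : 0 < η) :
    DifferentiableOn ℂ (boxModeSeriesC c) {z : ℂ | |z.im| < 1 - η} := by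
  have hopen : IsOpen {z : ℂ | |z.im| < 1 - η} :=
    isOpen_lt (continuous_abs.comp Complex.continuous_im) continuous_const
  have hC : 0 ≤ C := (abs_nonneg _).trans (hc 0)
  refine differentiableOn_tsum_of_summable_norm (u := fun k : ℕ => 4 * C * Real.exp (-(π * k * η)))
    (summable_majorant C hη) (fun k => ((differentiable_boxModeC k).const_mul _).differentiableOn) hopen ?_
  intro k z hz
  refine (norm_boxModeC_div_sinh_le k (c k) (le_of_lt hz)).trans ?_
  gcongr
  exact hc k

/-- On the strip the real series is the real part of the complex one (termwise `boxMode_eq_re`,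
summability from the majorant). [folklore] -/
theorem boxModeSeries_eq_re {c : ℕ → ℝ} {C : ℝ} (hc : ∀ k, |c k| ≤ C) {z : ℂ} (hz : |z.im| < 1) :
    boxModeSeries c z = (boxModeSeriesC c z).re := by
  have hC : 0 ≤ C := (abs_nonneg _).trans (hc 0)
  set η : ℝ := (1 - |z.im|) / 2 with hη
  have hη0 : 0 < η := by rw [hη]; linarith
  have hzη : |z.im| ≤ 1 - η := by rw [hη]; linarith
  have hsum : Summable fun k : ℕ => ((c k / Real.sinh (π * k) : ℝ) : ℂ) * boxModeC k z := by
    refine Summable.of_norm_bounded (summable_majorant C hη0) fun k => ?_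
    exact (norm_boxModeC_div_sinh_le k (c k) hzη).trans (by gcongr; exact hc k)
  rw [boxModeSeriesC, Complex.re_tsum hsum, boxModeSeries]
  refine tsum_congr fun k => ?_
  rw [Complex.re_ofReal_mul, boxMode_eq_re]

/-- **The box-mode series with bounded coefficients is harmonic on the strip `{|im z| < 1}`**
(the continuum Dirichlet solution on the box; harmonic as the real part of a holomorphic function).
[cite: LawlerSchrammWerner2004, Lemma 5.3] -/
theorem harmonicOnNhd_boxModeSeries {c : ℕ → ℝ} {C : ℝ} (hc : ∀ k, |c k| ≤ C) :
    HarmonicOnNhd (boxModeSeries c) {z : ℂ | |z.im| < 1} := by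
  intro z hz
  set η : ℝ := (1 - |z.im|) / 2 with hη
  have hη0 : 0 < η := by rw [hη]; simp only [mem_setOf_eq] at hz; linarith
  have hopen : IsOpen {w : ℂ | |w.im| < 1 - η} :=
    isOpen_lt (continuous_abs.comp Complex.continuous_im) continuous_const
  have hzmem : z ∈ {w : ℂ | |w.im| < 1 - η} := by
    simp only [mem_setOf_eq] at hz ⊢; rw [hη]; linarith
  -- the complex series is analytic at `z`, so its real part is harmonic at `z`
  have han : AnalyticAt ℂ (boxModeSeriesC c) z :=
    (differentiableOn_boxModeSeriesC hc hη0).analyticAt (hopen.mem_nhds hzmem)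
  have hre : HarmonicAt (fun w => (boxModeSeriesC c w).re) z := han.harmonicAt_re
  -- the real series agrees with that real part near `z`
  refine (harmonicAt_congr_nhds ?_).1 hre
  filter_upwards [hopen.mem_nhds hzmem] with w hw
  have hw' : |w.im| < 1 - η := hw
  have hw1 : |w.im| < 1 := by linarith
  exact (boxModeSeries_eq_re hc hw1).symm

end Literature.Analysis.Complex
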